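import Mathlib
import HarnessLib

/-!
# Crux `NewtonUnitEquations.DissociatedUniform` (stmt-ValiantsHypothesis-5905), `n = 3` totals law of model (Q**):
# the HEAVY-PAIR / UP-CROSSING count (combinatorial core of the first sub-cubic general bound)

Pure combinatorics, no geometry.  A TOP SYSTEM is a map `T : ℕ → G → G`: at each (sample) time `i` every fibre `f : G`
has a top letter `T i f`.  Its DEGREES are `topDeg T i ℓ = #{f : T i f = ℓ}` (`∑_ℓ topDeg = |G|`, so at most `|G|/h`
letters are `h`-heavy at any time, `mul_card_heavy_le`).  The system is an INTERVAL SYSTEM up to time `N`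
(`IsIntervalSys N T`) if the set of times `≤ N` at which a letter tops a given fibre is order-connected — this is what the
chart calculus gives for the tie-broken top letters of the pair fibres of the totals law (companion files).

* `suc N T m ℓ` — the STRONG UP-CROSSINGS of the letter `ℓ` at level `m`: times `r ≤ N` at which the degree of `ℓ` rises to
  `≥ m/2 + 1` (or `r = 0`) and then stays `≥ m/2 + 1` until some time of degree `≥ m`.  KEY COUNT `card_suc_mul_le`:
  `⌈m/2⌉ · #suc ≤ #{fibres ever topped by ℓ}` — each strong up-crossing consumes `⌈m/2⌉` fresh fibre entries of `ℓ`, and by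
  the interval property a fibre enters at most once; hence `⌈m/2⌉ · ∑_ℓ #suc_ℓ ≤ |G|²` (`sum_card_suc_mul_le`).
* `heavyPairs_mul_le` — for two interval systems `TQ`, `TR`: the pairs `(x, y)` such that at SOME common time `x` is `m`-heavy
  in `TR` and `y` is `m`-heavy in `TQ` number at most `2|G|³ / (⌈m/2⌉ (⌊m/2⌋ + 1)) ≤ 8|G|³/m²`: at a common heavy time, go back
  to the later of the two heavy-run starts — a strong up-crossing of one letter at which the other letter is still heavy.
* `sum_min_topDeg_le` — consequently, for ANY assignment of times `b p ≤ N` to pairs,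
  `∑_{(x,y)} min (topDeg TQ (b(x,y)) y) (topDeg TR (b(x,y)) x) ≤ 2K|G|² + 16|G|³/K` for every `K ≥ 1` (dyadic layer cake).
The companion `…TotalsLawTriangleWords` turns this into a bound on triangle words, `…TotalsLawChartSamples` supplies the interval
systems from the geometry, and `…TotalsLawSubCubic` concludes `T(a,b,c) = O(|G|^{5/2})`.  Nothing here is specific to VP ≠ VNP.
[folklore]
-/

set_option linter.dupNamespace false -- `ValiantsHypothesis.ValiantsHypothesis` (summit = problem) in every name

open Finset

namespace Summit.ValiantsHypothesis.ValiantsHypothesis.Theorems.NewtonUnitEquationsDissociatedUniform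

namespace TotalsLaw

variable {G : Type*} [Fintype G] [DecidableEq G]

/-! ### Degrees of a top system -/

/-- The degree of the letter `ℓ` at time `i`: the number of fibres whose top letter is `ℓ`. -/
def topDeg (T : ℕ → G → G) (i : ℕ) (ℓ : G) : ℕ := (univ.filter fun f => T i f = ℓ).card

/-- The degrees at a fixed time add up to the number of fibres. [folklore] -/
theorem sum_topDeg (T : ℕ → G → G) (i : ℕ) : ∑ ℓ, topDeg T i ℓ = Fintype.card G := by
  unfold topDeg
  rw [← Finset.card_univ, Finset.card_eq_sum_card_fiberwise (f := T i) (t := univ) fun _ _ => mem_univ _]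

/-- A degree is at most the number of fibres. [folklore] -/
theorem topDeg_le (T : ℕ → G → G) (i : ℕ) (ℓ : G) : topDeg T i ℓ ≤ Fintype.card G := by
  unfold topDeg
  exact (card_filter_le _ _).trans (by rw [card_univ])

/-- **Few heavy letters.**  `h · #{ℓ : h ≤ topDeg T i ℓ} ≤ |G|`. [folklore] -/
theorem mul_card_heavy_le (T : ℕ → G → G) (i h : ℕ) :
    h * (univ.filter fun ℓ => h ≤ topDeg T i ℓ).card ≤ Fintype.card G := by
  rw [mul_comm, Finset.card_eq_sum_ones, Finset.sum_mul, one_mul]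
  calc ∑ ℓ ∈ univ.filter (fun ℓ => h ≤ topDeg T i ℓ), h
      ≤ ∑ ℓ ∈ univ.filter (fun ℓ => h ≤ topDeg T i ℓ), topDeg T i ℓ :=
        Finset.sum_le_sum fun ℓ hℓ => (mem_filter.1 hℓ).2
    _ ≤ ∑ ℓ, topDeg T i ℓ := Finset.sum_le_sum_of_subset_of_nonneg (filter_subset _ _) fun _ _ _ => Nat.zero_le _
    _ = Fintype.card G := sum_topDeg T i

/-! ### Interval systems and strong up-crossings -/

/-- `T` is an INTERVAL SYSTEM up to time `N`: for each fibre `f` and letter `ℓ`, the times `≤ N` at which `ℓ` tops `f` form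
an order-connected set. -/
def IsIntervalSys (N : ℕ) (T : ℕ → G → G) : Prop :=
  ∀ f ℓ i j k, i ≤ j → j ≤ k → k ≤ N → T i f = ℓ → T k f = ℓ → T j f = ℓ

open Classical in
/-- The STRONG UP-CROSSINGS of `ℓ` at level `m` (half level `h = m/2 + 1`): times `r ≤ N` with (`r = 0` or degree `< h` just
before `r`), followed by a run of degrees `≥ h` on `[r, i]` ending at a time `i ≤ N` of degree `≥ m`. -/
noncomputable def suc (N : ℕ) (T : ℕ → G → G) (m : ℕ) (ℓ : G) : Finset ℕ :=
  (range (N + 1)).filter fun r =>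
    (r = 0 ∨ topDeg T (r - 1) ℓ < m / 2 + 1) ∧
      ∃ i, r ≤ i ∧ i ≤ N ∧ m ≤ topDeg T i ℓ ∧ ∀ j, r ≤ j → j ≤ i → m / 2 + 1 ≤ topDeg T j ℓ

/-- **Heavy runs start at strong up-crossings.**  If `ℓ` has degree `≥ m ≥ 1` at a time `i ≤ N`, the maximal run of degrees
`≥ m/2 + 1` ending at `i` starts at a strong up-crossing `r ≤ i`. [folklore] -/
theorem exists_suc_run (N : ℕ) (T : ℕ → G → G) {m : ℕ} (hm : 1 ≤ m) (ℓ : G) {i : ℕ} (hi : i ≤ N)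
    (hdeg : m ≤ topDeg T i ℓ) :
    ∃ r ∈ suc N T m ℓ, r ≤ i ∧ ∀ j, r ≤ j → j ≤ i → m / 2 + 1 ≤ topDeg T j ℓ := by
  classical
  have hex : ∃ r, ∀ j, r ≤ j → j ≤ i → m / 2 + 1 ≤ topDeg T j ℓ :=
    ⟨i, fun j h1 h2 => by rw [le_antisymm h2 h1]; omega⟩
  refine ⟨Nat.find hex, ?_, Nat.find_min' hex (fun j h1 h2 => by rw [le_antisymm h2 h1]; omega), Nat.find_spec hex⟩
  have hri : Nat.find hex ≤ i := Nat.find_min' hex fun j h1 h2 => by rw [le_antisymm h2 h1]; omega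
  refine mem_filter.2 ⟨mem_range.2 (by omega), ?_, i, hri, hi, hdeg, Nat.find_spec hex⟩
  by_cases h0 : Nat.find hex = 0
  · exact Or.inl h0
  · refine Or.inr (lt_of_not_ge fun hge => ?_)
    have hmin := Nat.find_min hex (m := Nat.find hex - 1) (by omega)
    exact hmin fun j h1 h2 => by
      by_cases hj : j = Nat.find hex - 1
      · rw [hj]; exact hge
      · exact Nat.find_spec hex j (by omega) h2

/-- **Each strong up-crossing consumes `⌈m/2⌉` fresh fibre entries.**
`⌈m/2⌉ · #suc ≤ #{f : ℓ tops f at some time ≤ N}` for an interval system. [folklore] -/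
theorem card_suc_mul_le {N : ℕ} {T : ℕ → G → G} (hT : IsIntervalSys N T) (m : ℕ) (ℓ : G) :
    (m + 1) / 2 * (suc N T m ℓ).card ≤ (univ.filter fun f => ∃ i ≤ N, T i f = ℓ).card := by
  classical
  -- a witness time for every strong up-crossing
  have hw : ∀ r ∈ suc N T m ℓ, ∃ i, r ≤ i ∧ i ≤ N ∧ m ≤ topDeg T i ℓ ∧
      ∀ j, r ≤ j → j ≤ i → m / 2 + 1 ≤ topDeg T j ℓ := fun r hr => (mem_filter.1 hr).2.2
  choose! wit hwit1 hwit2 hwit3 hwit4 using hw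
  have hup : ∀ r ∈ suc N T m ℓ, r = 0 ∨ topDeg T (r - 1) ℓ < m / 2 + 1 := fun r hr => (mem_filter.1 hr).2.1
  -- the fibres charged to `r`: topped by `ℓ` at the witness time, not just before `r`
  set ch : ℕ → Finset G := fun r => univ.filter fun f => T (wit r) f = ℓ ∧ (r = 0 ∨ T (r - 1) f ≠ ℓ) with hch
  -- (1) each charged set is large
  have h1 : ∀ r ∈ suc N T m ℓ, (m + 1) / 2 ≤ (ch r).card := by
    intro r hr
    rcases hup r hr with h0 | hlt
    · have : ch r = univ.filter fun f => T (wit r) f = ℓ := by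
        rw [hch]; exact filter_congr fun f _ => by simp [h0]
      rw [this]
      exact le_trans (by omega) (hwit3 r hr)
    · have hsub : (univ.filter fun f => T (wit r) f = ℓ) \ (univ.filter fun f => T (r - 1) f = ℓ) ⊆ ch r := by
        intro f hf
        rw [mem_sdiff, mem_filter, mem_filter] at hf
        exact mem_filter.2 ⟨mem_univ _, hf.1.2, Or.inr fun h => hf.2 ⟨mem_univ _, h⟩⟩
      have hcard := card_le_card hsub
      have hsd := le_card_sdiff (univ.filter fun f => T (r - 1) f = ℓ) (univ.filter fun f => T (wit r) f = ℓ)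
      have e1 : (univ.filter fun f => T (wit r) f = ℓ).card = topDeg T (wit r) ℓ := rfl
      have e2 : (univ.filter fun f => T (r - 1) f = ℓ).card = topDeg T (r - 1) ℓ := rfl
      have := hwit3 r hr
      omega
  -- (2) the charged sets are pairwise disjoint
  have h2aux : ∀ r ∈ suc N T m ℓ, ∀ r' ∈ suc N T m ℓ, r < r' → Disjoint (ch r) (ch r') := by
    intro r hr r' hr' hlt
    rw [Finset.disjoint_left]
    intro f hf hf'
    obtain ⟨-, hfw, -⟩ := mem_filter.1 hf
    obtain ⟨-, hfw', h0⟩ := mem_filter.1 hf'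
    rcases h0 with h0 | hne
    · omega
    · -- `wit r < r' - 1 < r' ≤ wit r'`, all topped by `ℓ` at both ends: interval property
      have hlt' : wit r < r' - 1 := by
        by_contra hge
        push Not at hge
        have := hwit4 r hr (r' - 1) (by omega) hge
        rcases hup r' hr' with h | h
        · omega
        · omega
      exact hne (hT f ℓ (wit r) (r' - 1) (wit r') hlt'.le (by have := hwit1 r' hr'; omega) (hwit2 r' hr') hfw hfw')
  have h2 : (suc N T m ℓ : Set ℕ).PairwiseDisjoint ch := by
    intro r hr r' hr' hne
    rcases lt_or_gt_of_ne hne with h | h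
    · exact h2aux r hr r' hr' h
    · exact (h2aux r' hr' r hr h).symm
  -- (3) all charged fibres are topped by `ℓ` at some time `≤ N`
  have h3 : (suc N T m ℓ).biUnion ch ⊆ univ.filter fun f => ∃ i ≤ N, T i f = ℓ := by
    intro f hf
    obtain ⟨r, hr, hfr⟩ := mem_biUnion.1 hf
    exact mem_filter.2 ⟨mem_univ _, wit r, hwit2 r hr, (mem_filter.1 hfr).2.1⟩
  calc (m + 1) / 2 * (suc N T m ℓ).card = ∑ _r ∈ suc N T m ℓ, (m + 1) / 2 := by
        rw [sum_const, smul_eq_mul, mul_comm]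
    _ ≤ ∑ r ∈ suc N T m ℓ, (ch r).card := sum_le_sum h1
    _ = ((suc N T m ℓ).biUnion ch).card := (card_biUnion h2).symm
    _ ≤ (univ.filter fun f => ∃ i ≤ N, T i f = ℓ).card := card_le_card h3

/-- **`⌈m/2⌉ · ∑_ℓ #suc_ℓ ≤ |G|²`.** [folklore] -/
theorem sum_card_suc_mul_le {N : ℕ} {T : ℕ → G → G} (hT : IsIntervalSys N T) (m : ℕ) :
    (m + 1) / 2 * ∑ ℓ, (suc N T m ℓ).card ≤ Fintype.card G ^ 2 := by
  rw [mul_sum]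
  calc ∑ ℓ, (m + 1) / 2 * (suc N T m ℓ).card ≤ ∑ ℓ : G, (univ.filter fun f => ∃ i ≤ N, T i f = ℓ).card :=
        sum_le_sum fun ℓ _ => card_suc_mul_le hT m ℓ
    _ ≤ ∑ _ℓ : G, Fintype.card G := sum_le_sum fun ℓ _ => (card_filter_le _ _).trans (by rw [card_univ])
    _ = Fintype.card G ^ 2 := by rw [sum_const, card_univ, smul_eq_mul, sq]

/-! ### Heavy pairs -/

open Classical in
/-- The pairs `(x, y)` which at some common time `≤ N` are both `m`-heavy: `x` in `TR`, `y` in `TQ`. -/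
noncomputable def heavyPairs (N : ℕ) (TQ TR : ℕ → G → G) (m : ℕ) : Finset (G × G) :=
  univ.filter fun p => ∃ i ≤ N, m ≤ topDeg TQ i p.2 ∧ m ≤ topDeg TR i p.1

/-- The heavy pairs are covered by (strong up-crossing of one letter) × (letters heavy at that time). [folklore] -/
theorem heavyPairs_subset {N : ℕ} (TQ TR : ℕ → G → G) {m : ℕ} (hm : 1 ≤ m) :
    heavyPairs N TQ TR m ⊆
      (univ.biUnion fun x => (suc N TR m x).biUnion fun r =>
          (univ.filter fun y => m / 2 + 1 ≤ topDeg TQ r y).image fun y => (x, y)) ∪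
      (univ.biUnion fun y => (suc N TQ m y).biUnion fun r =>
          (univ.filter fun x => m / 2 + 1 ≤ topDeg TR r x).image fun x => (x, y)) := by
  classical
  rintro ⟨x, y⟩ hp
  obtain ⟨-, i, hi, hy, hx⟩ := mem_filter.1 hp
  obtain ⟨rR, hrR, hrRi, hrunR⟩ := exists_suc_run N TR hm x hi hx
  obtain ⟨rQ, hrQ, hrQi, hrunQ⟩ := exists_suc_run N TQ hm y hi hy
  rw [mem_union, mem_biUnion, mem_biUnion]
  rcases le_total rQ rR with h | h
  · refine Or.inl ⟨x, mem_univ _, mem_biUnion.2 ⟨rR, hrR, mem_image.2 ⟨y, ?_, rfl⟩⟩⟩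
    exact mem_filter.2 ⟨mem_univ _, hrunQ rR h hrRi⟩
  · refine Or.inr ⟨y, mem_univ _, mem_biUnion.2 ⟨rQ, hrQ, mem_image.2 ⟨x, ?_, rfl⟩⟩⟩
    exact mem_filter.2 ⟨mem_univ _, hrunR rQ h hrQi⟩

/-- **Heavy-pair bound.**  `⌈m/2⌉ · (⌊m/2⌋ + 1) · #heavyPairs ≤ 2|G|³` for interval systems (so `#heavyPairs ≤ 8|G|³/m²`).
[folklore] -/
theorem heavyPairs_mul_le {N : ℕ} {TQ TR : ℕ → G → G} (hQ : IsIntervalSys N TQ) (hR : IsIntervalSys N TR) (m : ℕ) :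
    (m + 1) / 2 * ((m / 2 + 1) * (heavyPairs N TQ TR m).card) ≤ 2 * Fintype.card G ^ 3 := by
  classical
  rcases Nat.eq_zero_or_pos m with rfl | hm
  · norm_num
  set q := Fintype.card G with hq
  set h := m / 2 + 1 with hh
  -- the two covering families
  set A := univ.biUnion fun x => (suc N TR m x).biUnion fun r =>
      (univ.filter fun y => h ≤ topDeg TQ r y).image fun y => (x, y) with hA
  set B := univ.biUnion fun y => (suc N TQ m y).biUnion fun r =>
      (univ.filter fun x => h ≤ topDeg TR r x).image fun x => (x, y) with hB
  have hcov : (heavyPairs N TQ TR m).card ≤ A.card + B.card :=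
    (card_le_card (heavyPairs_subset TQ TR hm)).trans (card_union_le _ _)
  have hAc : h * A.card ≤ q * ∑ x, (suc N TR m x).card := by
    calc h * A.card ≤ h * ∑ x, ∑ r ∈ suc N TR m x, ((univ.filter fun y => h ≤ topDeg TQ r y).image fun y => (x, y)).card := by
          gcongr
          exact card_biUnion_le.trans (sum_le_sum fun x _ => card_biUnion_le)
      _ = ∑ x, ∑ r ∈ suc N TR m x, h * ((univ.filter fun y => h ≤ topDeg TQ r y).image fun y => (x, y)).card := by
          rw [mul_sum]; refine sum_congr rfl fun x _ => ?_; rw [mul_sum]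
      _ ≤ ∑ x, ∑ _r ∈ suc N TR m x, q := by
          gcongr with x _ r _
          exact (Nat.mul_le_mul_left _ card_image_le).trans (mul_card_heavy_le TQ r h)
      _ = q * ∑ x, (suc N TR m x).card := by
          rw [mul_sum]; refine sum_congr rfl fun x _ => ?_; rw [sum_const, smul_eq_mul, mul_comm]
  have hBc : h * B.card ≤ q * ∑ y, (suc N TQ m y).card := by
    calc h * B.card ≤ h * ∑ y, ∑ r ∈ suc N TQ m y, ((univ.filter fun x => h ≤ topDeg TR r x).image fun x => (x, y)).card := by
          gcongr
          exact card_biUnion_le.trans (sum_le_sum fun y _ => card_biUnion_le)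
      _ = ∑ y, ∑ r ∈ suc N TQ m y, h * ((univ.filter fun x => h ≤ topDeg TR r x).image fun x => (x, y)).card := by
          rw [mul_sum]; refine sum_congr rfl fun y _ => ?_; rw [mul_sum]
      _ ≤ ∑ y, ∑ _r ∈ suc N TQ m y, q := by
          gcongr with y _ r _
          exact (Nat.mul_le_mul_left _ card_image_le).trans (mul_card_heavy_le TR r h)
      _ = q * ∑ y, (suc N TQ m y).card := by
          rw [mul_sum]; refine sum_congr rfl fun y _ => ?_; rw [sum_const, smul_eq_mul, mul_comm]
  have hR' := sum_card_suc_mul_le hR m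
  have hQ' := sum_card_suc_mul_le hQ m
  calc (m + 1) / 2 * (h * (heavyPairs N TQ TR m).card)
      ≤ (m + 1) / 2 * (h * A.card + h * B.card) := by
        gcongr; rw [← mul_add]; exact Nat.mul_le_mul_left _ hcov
    _ ≤ (m + 1) / 2 * (q * ∑ x, (suc N TR m x).card + q * ∑ y, (suc N TQ m y).card) := by gcongr
    _ = q * ((m + 1) / 2 * ∑ x, (suc N TR m x).card) + q * ((m + 1) / 2 * ∑ y, (suc N TQ m y).card) := by ring
    _ ≤ q * q ^ 2 + q * q ^ 2 := by gcongr
    _ = 2 * q ^ 3 := by ring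

/-- The heavy-pair bound at a dyadic level `m = 2^j`, in the form used by the layer cake:
`2^j · #heavyPairs(2^j) ≤ 8|G|³ / 2^j`. [folklore] -/
theorem pow_mul_card_heavyPairs_le {N : ℕ} {TQ TR : ℕ → G → G} (hQ : IsIntervalSys N TQ) (hR : IsIntervalSys N TR)
    (j : ℕ) : 2 ^ j * (heavyPairs N TQ TR (2 ^ j)).card ≤ 8 * Fintype.card G ^ 3 / 2 ^ j := by
  have hpos : 0 < 2 ^ j := Nat.two_pow_pos j
  rw [Nat.le_div_iff_mul_le hpos]
  have hmain := heavyPairs_mul_le hQ hR (2 ^ j)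
  rcases Nat.eq_zero_or_pos j with rfl | hj
  · -- `m = 1`: `#heavyPairs ≤ |G|²  ≤ 8|G|³`
    have hc : (heavyPairs N TQ TR (2 ^ 0)).card ≤ Fintype.card G ^ 2 := by
      unfold heavyPairs
      exact (card_filter_le _ _).trans (by rw [card_univ, Fintype.card_prod, sq])
    have hq : Fintype.card G ^ 2 ≤ Fintype.card G ^ 3 := by
      rcases Nat.eq_zero_or_pos (Fintype.card G) with h0 | hpos'
      · simp [h0]
      · exact Nat.pow_le_pow_right hpos' (by norm_num)
    simp only [pow_zero, one_mul, mul_one] at hc ⊢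
    omega
  · -- `m = 2^j`, `j ≥ 1`: `⌈m/2⌉ = 2^(j-1)`, `⌊m/2⌋ + 1 = 2^(j-1) + 1`
    obtain ⟨k, rfl⟩ : ∃ k, j = k + 1 := ⟨j - 1, by omega⟩
    have e1 : (2 ^ (k + 1) + 1) / 2 = 2 ^ k := by rw [pow_succ]; omega
    have e2 : 2 ^ (k + 1) / 2 + 1 = 2 ^ k + 1 := by rw [pow_succ]; omega
    rw [e1, e2] at hmain
    set c := (heavyPairs N TQ TR (2 ^ (k + 1))).card
    have h4 : 2 ^ k * (2 ^ k * c) ≤ 2 * Fintype.card G ^ 3 :=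
      le_trans (Nat.mul_le_mul_left _ (Nat.mul_le_mul_right _ (Nat.le_succ _))) hmain
    calc 2 ^ (k + 1) * c * 2 ^ (k + 1) = 4 * (2 ^ k * (2 ^ k * c)) := by ring
      _ ≤ 4 * (2 * Fintype.card G ^ 3) := Nat.mul_le_mul_left _ h4
      _ = 8 * Fintype.card G ^ 3 := by ring

/-! ### The dyadic layer cake -/

/-- Dyadic layer cake: `f ≤ ∑_{j ≤ log₂ q} 2^j · [2^j ≤ f]` for `f ≤ q`. [folklore] -/
theorem le_sum_pow_indicator {f q : ℕ} (hf : f ≤ q) :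
    f ≤ ∑ j ∈ range (Nat.log 2 q + 1), 2 ^ j * (if 2 ^ j ≤ f then 1 else 0) := by
  rcases Nat.eq_zero_or_pos f with rfl | hpos
  · exact Nat.zero_le _
  set t := Nat.log 2 f with ht
  have htJ : t + 1 ≤ Nat.log 2 q + 1 := Nat.succ_le_succ (Nat.log_mono_right hf)
  have hlt : f < 2 ^ (t + 1) := Nat.lt_pow_succ_log_self (by norm_num) f
  -- geometric sum
  have hgeom : ∀ n, ∑ j ∈ range n, 2 ^ j + 1 = 2 ^ n := by
    intro n; induction n with
    | zero => simp
    | succ n ih => rw [sum_range_succ, pow_succ]; omega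
  calc f ≤ 2 ^ (t + 1) - 1 := by omega
    _ = ∑ j ∈ range (t + 1), 2 ^ j := by have := hgeom (t + 1); omega
    _ = ∑ j ∈ range (t + 1), 2 ^ j * (if 2 ^ j ≤ f then 1 else 0) := by
        refine sum_congr rfl fun j hj => ?_
        have hj' : 2 ^ j ≤ f := (Nat.pow_le_pow_right (by norm_num) (Nat.lt_succ_iff.1 (mem_range.1 hj))).trans
          (Nat.pow_log_le_self 2 hpos.ne')
        rw [if_pos hj', mul_one]
    _ ≤ ∑ j ∈ range (Nat.log 2 q + 1), 2 ^ j * (if 2 ^ j ≤ f then 1 else 0) :=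
        sum_le_sum_of_subset_of_nonneg (range_subset_range.2 htJ) fun _ _ _ => Nat.zero_le _

/-- Halving sums: `∑_{j ≤ J, j₀ ≤ j} X / 2^j ≤ 2 · (X / 2^{j₀})`. [folklore] -/
theorem sum_div_pow_le (X j₀ J : ℕ) :
    ∑ j ∈ range (J + 1), (if j₀ ≤ j then X / 2 ^ j else 0) ≤ 2 * (X / 2 ^ j₀) := by
  -- strengthened induction: `S(J) + [j₀ ≤ J] X/2^J ≤ 2 X/2^{j₀}`
  have hzero : ∀ J, J < j₀ → ∑ j ∈ range (J + 1), (if j₀ ≤ j then X / 2 ^ j else 0) = 0 := by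
    intro J hJ
    exact sum_eq_zero fun j hj => by rw [if_neg]; have := mem_range.1 hj; omega
  have hhalf : ∀ j, 2 * (X / 2 ^ (j + 1)) ≤ X / 2 ^ j := by
    intro j
    rw [pow_succ, ← Nat.div_div_eq_div_mul]
    exact Nat.mul_div_le _ _
  suffices h : ∀ J, ∑ j ∈ range (J + 1), (if j₀ ≤ j then X / 2 ^ j else 0) +
      (if j₀ ≤ J then X / 2 ^ J else 0) ≤ 2 * (X / 2 ^ j₀) from le_trans (Nat.le_add_right _ _) (h J)
  intro J
  induction J with
  | zero =>
    by_cases h0 : j₀ ≤ 0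
    · have : j₀ = 0 := by omega
      subst this; simp; omega
    · rw [if_neg h0, hzero 0 (by omega)]
      exact Nat.zero_le _
  | succ J ih =>
    by_cases hle : j₀ ≤ J
    · rw [if_pos hle] at ih
      rw [sum_range_succ, if_pos (show j₀ ≤ J + 1 by omega)]
      have := hhalf J
      omega
    · by_cases heq : j₀ = J + 1
      · subst heq
        rw [sum_range_succ, hzero J (by omega), if_pos le_rfl]
        omega
      · rw [sum_range_succ, hzero J (by omega), if_neg (by omega)]
        exact Nat.zero_le _

/-- **The sum of minima.**  For interval systems `TQ`, `TR` up to `N`, any times `b p ≤ N`, and any `K ≥ 1`: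
`∑_{(x,y)} min (topDeg TQ (b (x,y)) y) (topDeg TR (b (x,y)) x) ≤ 2K|G|² + 16|G|³/K`. [folklore] -/
theorem sum_min_topDeg_le {N : ℕ} {TQ TR : ℕ → G → G} (hQ : IsIntervalSys N TQ) (hR : IsIntervalSys N TR)
    (b : G × G → ℕ) (hb : ∀ p, b p ≤ N) {K : ℕ} (hK : 1 ≤ K) :
    ∑ p : G × G, min (topDeg TQ (b p) p.2) (topDeg TR (b p) p.1) ≤
      2 * K * Fintype.card G ^ 2 + 16 * Fintype.card G ^ 3 / K := by
  classical
  set q := Fintype.card G with hq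
  set J := Nat.log 2 q with hJ
  set f : G × G → ℕ := fun p => min (topDeg TQ (b p) p.2) (topDeg TR (b p) p.1) with hf
  have hfq : ∀ p, f p ≤ q := fun p => (min_le_left _ _).trans (topDeg_le _ _ _)
  -- layer cake
  have step1 : ∑ p, f p ≤ ∑ j ∈ range (J + 1), 2 ^ j * (heavyPairs N TQ TR (2 ^ j)).card := by
    calc ∑ p, f p ≤ ∑ p : G × G, ∑ j ∈ range (J + 1), 2 ^ j * (if 2 ^ j ≤ f p then 1 else 0) :=
          sum_le_sum fun p _ => le_sum_pow_indicator (hfq p)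
      _ = ∑ j ∈ range (J + 1), 2 ^ j * ∑ p : G × G, (if 2 ^ j ≤ f p then 1 else 0) := by
          rw [sum_comm]; exact sum_congr rfl fun j _ => by rw [mul_sum]
      _ ≤ ∑ j ∈ range (J + 1), 2 ^ j * (heavyPairs N TQ TR (2 ^ j)).card := by
          refine sum_le_sum fun j _ => Nat.mul_le_mul_left _ ?_
          rw [← Finset.card_filter]
          refine card_le_card fun p hp => ?_
          obtain ⟨-, hp⟩ := mem_filter.1 hp
          exact mem_filter.2 ⟨mem_univ _, b p, hb p, (le_min_iff.1 hp).1, (le_min_iff.1 hp).2⟩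
  -- the threshold
  set j₀ := Nat.log 2 K + 1 with hj₀
  have hKlt : K < 2 ^ j₀ := Nat.lt_pow_succ_log_self (by norm_num) K
  have hKge : 2 ^ j₀ ≤ 2 * K := by
    have := Nat.pow_log_le_self 2 (show K ≠ 0 by omega); rw [hj₀, pow_succ]; omega
  have step2 : ∀ j ∈ range (J + 1), 2 ^ j * (heavyPairs N TQ TR (2 ^ j)).card ≤
      (if j < j₀ then 2 ^ j * q ^ 2 else 0) + (if j₀ ≤ j then 8 * q ^ 3 / 2 ^ j else 0) := by
    intro j _
    by_cases hj : j < j₀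
    · rw [if_pos hj, if_neg (by omega), add_zero]
      refine Nat.mul_le_mul_left _ ?_
      unfold heavyPairs
      exact (card_filter_le _ _).trans (by rw [card_univ, Fintype.card_prod, sq])
    · rw [if_neg hj, if_pos (by omega), zero_add]
      exact pow_mul_card_heavyPairs_le hQ hR j
  have hgeom : ∀ n, ∑ j ∈ range n, 2 ^ j + 1 = 2 ^ n := by
    intro n; induction n with
    | zero => simp
    | succ n ih => rw [sum_range_succ, pow_succ]; omega
  have step3 : ∑ j ∈ range (J + 1), (if j < j₀ then 2 ^ j * q ^ 2 else 0) ≤ (2 * K) * q ^ 2 := by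
    calc ∑ j ∈ range (J + 1), (if j < j₀ then 2 ^ j * q ^ 2 else 0)
        ≤ ∑ j ∈ range (J + 1 + j₀), (if j < j₀ then 2 ^ j * q ^ 2 else 0) :=
          sum_le_sum_of_subset_of_nonneg (range_subset_range.2 (by omega)) fun _ _ _ => Nat.zero_le _
      _ = ∑ j ∈ range j₀, 2 ^ j * q ^ 2 := by
          rw [← sum_filter, show (range (J + 1 + j₀)).filter (fun j => j < j₀) = range j₀ from by
            ext j; simp only [mem_filter, mem_range]; omega]
      _ = (∑ j ∈ range j₀, 2 ^ j) * q ^ 2 := by rw [sum_mul]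
      _ ≤ (2 * K) * q ^ 2 := Nat.mul_le_mul_right _ (by have := hgeom j₀; omega)
  have step4 : ∑ j ∈ range (J + 1), (if j₀ ≤ j then 8 * q ^ 3 / 2 ^ j else 0) ≤ 16 * q ^ 3 / K := by
    calc ∑ j ∈ range (J + 1), (if j₀ ≤ j then 8 * q ^ 3 / 2 ^ j else 0) ≤ 2 * (8 * q ^ 3 / 2 ^ j₀) :=
          sum_div_pow_le _ _ _
      _ ≤ 2 * (8 * q ^ 3 / K) := Nat.mul_le_mul_left _ (Nat.div_le_div_left hKlt.le hK)
      _ ≤ 2 * (8 * q ^ 3) / K := Nat.mul_div_le_mul_div_assoc _ _ _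
      _ = 16 * q ^ 3 / K := by ring_nf
  calc ∑ p, f p ≤ ∑ j ∈ range (J + 1), 2 ^ j * (heavyPairs N TQ TR (2 ^ j)).card := step1
    _ ≤ ∑ j ∈ range (J + 1), ((if j < j₀ then 2 ^ j * q ^ 2 else 0) + (if j₀ ≤ j then 8 * q ^ 3 / 2 ^ j else 0)) :=
        sum_le_sum step2
    _ ≤ 2 * K * q ^ 2 + 16 * q ^ 3 / K := by rw [sum_add_distrib]; exact add_le_add step3 step4

end TotalsLaw

end Summit.ValiantsHypothesis.ValiantsHypothesis.Theorems.NewtonUnitEquationsDissociatedUniform
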